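import Mathlib
import Literature.MathematicalPhysics.QuantumFieldTheory.Balaban1983to89.B6OneScaleBoxFamily

/-!
# `Balaban1983to89.B6Prop22BoxFamily` — T. Bałaban, *Propagators and renormalization transformations for lattice gauge
theories. II*, Commun. Math. Phys. **96** (1984) 223–250 [Balaban1984PropagatorsII]: **Proposition 2.2 in its printed
typing `B6.Prop22Printed`, INHABITED by the one-scale box family of `…B6OneScaleBoxFamily` (G′ = (−Δ_𝔅 + a)⁻¹) with NO
analytic hypothesis** — witnesses (M₁, δ₀, C, C_α) depending on d and a only, uniform in the volume

statement-level skeleton of published theorems with citation tags; proofs where landed; nothing here is a claim about the Yang–Mills mass gap.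
PDF held: `paper:balaban1984-cmp96-propagators-rt-ii` (journal page = PDF page + 222); pp. 224–235 [PDF 2–13] read this
session (×2 renders `…-p012-x2.png`, `…-p013-x2.png`).

CITATION HEADER (cell `lit-balaban`, Phase-2 proof seat `p01` (gen 3) = unit `lit-balaban-p01`, HOME
`run/shared/lean/pub/lit-balaban/`, `PHASE2-TARGETS.md` §G, G.5-34(d)); SKELETON row **`B6.Prop2.2`** — the VERBATIM Prop
`B6.Prop22Printed` (b2b `…B6`) inhabited by a non-degenerate family with every analytic input PROVED (kind «model-instance»;
cf. the tower-family theorems `B6TowerPrinted.prop23Printed_towerFamily` for Prop. 2.3/2.7, which keep the kernel inputs as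
hypotheses).  Imports this seat's `…B6OneScaleBoxFamily` (objects) → `…B6Prop22BoxLaplacian` (p248905:
`prop22_entry1_neumannLaplacian`, the printed random-walk route (2.36)–(2.38), (2.43), (2.44), (2.50), (2.64)–(2.66) closed on
the model) → `…B6Ineq243BoxProof` (p248732).
WHAT THE PAPER PRINTS.  p. 234 [PDF 12]: *"Proposition 2.2. If we have (2.1), (2.2) and M is sufficiently large, then the
operator G′ = Δ′_a^{−1} (a = 1) satisfies the inequalities |(G′λ)(x)|, |(∇G′λ)(x)|, |(G′∇*λ)(x)|, ‖ζ∇G′λ‖_α, ‖ζG′∇*λ‖_α,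
|(ΔG′λ)(x)| ≤ O(1)[(L^jη)², L^jη, L^jη, (L^jη)^{1−α}(‖ζ‖_α + |ζ|), (L^jη)^{1−α}(‖ζ‖_α + |ζ|), 1]e^{−½δ₀d(y,y′)}|λ|, x ∈ B^j(y)
or supp ζ ⊂ B^j(y), y ∈ Λ_j, supp λ ⊂ B^{j′}(y′), y′ ∈ Λ_{j′}. (2.67)"*; p. 234, before it: *"The similar inequalities hold
for a derivative of G′λ and for a Hölder norm of a derivative, but with (L^jη)² replaced by L^jη and (L^jη)^{1−α}
correspondingly"*; p. 235: *"If we have one scale … the operator is a unit lattice operator."*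
WHAT IS PROVED HERE (0 sorry, 0 new definitions, 0 named facts):
§1 on the box, for any matrix G′ with `|G′(x,y)| ≤ C₀e^{−r|x−y|₁}` (r ≥ 0) and λ supported in {y′}: `entry0_le` (|(G′λ)(y)| ≤
  C₀e^{−r|y−y′|₁}|λ(y′)|), `entry1_le` (|(∇_μG′λ)(y)| ≤ C₀(e^r + 1)e^{−r|y−y′|₁}|λ(y′)|), `entry2_le` (|(G′∇_μ*λ)(y)| ≤ the same),
  `entry3_le` (|(ΔG′λ)(y)| ≤ (1 + |a|C₀)e^{−r|y−y′|₁}|λ(y′)| when ΔG′ = 1 − aG′), `holder_mul_le` (‖ζg‖_α ≤ |ζ(y)||g(y)| for ζ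
  supported at y, α ≥ 0) — on the unit lattice every entry of (2.67) follows from the kernel decay (the printed *"similar
  inequalities hold for a derivative … and for a Hölder norm"* is, at L^jη = 1, one step of the triangle inequality).
§2 **`prop22Printed_boxFamily d ha : B6.Prop22Printed (fun i : ℕ × ℕ => oneScaleGeo d i.1 i.2) (fun i => boxGp d i.1 i.2 a)`**
  for every d and every a > 0: witnesses δ₀ = log(1 + a/(4(d+1))) (so that 2d(e^{δ₀} − 1) < a), A = (a − 2d(e^{δ₀} − 1))⁻¹,
  X = 2^d(3π/2)A·2de^{δ₀}K(½δ₀), **M₁ = 2X + 1**, C₀ = 2·2^dAK(½δ₀) (the kernel constant of `prop22_entry1_neumannLaplacian`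
  with (1 − X/M)⁻¹ ≤ 2), r = ½δ₀, C = 1 + |a|C₀ + (d+1)C₀(e^r + 1), C_α ≡ 2dC₀(e^r + 1): for EVERY member (n, M) with M ≥ M₁
  all four sup entries are ≤ C·e^{−½δ₀|y−y′|₁}|λ| and the Hölder entries ≤ C_α(‖ζ‖_α + |ζ|)e^{−½δ₀|y−y′|₁}|λ| (0 ≤ α < 1).
§3 (v1.1) `boxFamily_meets_hypotheses` / `boxFamily_meets_hypotheses_mono`: for every threshold M₁ and every n there is a
  member (n, M) with `Hyp21_22` and `M₁ ≤ M`, and every larger M again qualifies — the verbatim Prop is inhabited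
  NON-VACUOUSLY (its bounds are asserted on boxes of every aspect n and every M ≥ M₁, not on an empty subfamily).
HONEST SCOPE.  One scale (blocks = sites, L^jη = 1, so the prefactor table is ≡ 1 and the Hölder gain (L^jη)^{1−α} is
invisible); box with Neumann conventions, not the torus; the readings of `Loc/suppIn/supNorm/Cut/cutIn/cutH` are those of
`…B6OneScaleBoxFamily` (documented there); entries 1, 2 and h1 are the sums over μ, which dominate the printed componentwise
quantities.  The decay itself is the companion's theorem; this file is the dictionary to the verbatim Prop.
-/

namespace Literature.MathematicalPhysics.QuantumFieldTheory.Balaban1983to89.B6Prop22BoxFamily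

open Finset Matrix
open B6CoverBox (bdist Kbox bdist_self bdist_comm bdist_triangle bdist_nonneg crd)
open B6Prop22BoxLaplacian (prop22_entry1_neumannLaplacian)
open B6OneScaleBoxFamily

noncomputable section

variable {d S : ℕ}

/-! ## §1. Kernel decay ⇒ the six quantities of (2.67) on the unit-lattice box (blocks = sites) -/

section EntryBounds

variable {G : Matrix (Fin d → Fin S) (Fin d → Fin S) ℝ} {C₀ r : ℝ} {lam : (Fin d → Fin S) → ℝ} {y' : Fin d → Fin S}

/-- A function supported in the block {y′} is `λ = λ(y′)δ_{y′}`: `(Gλ)(z) = G(z,y′)λ(y′)`. [folklore] -/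
private theorem mulVec_of_supp (G : Matrix (Fin d → Fin S) (Fin d → Fin S) ℝ) (hlam : ∀ x, x ≠ y' → lam x = 0)
    (z : Fin d → Fin S) : (G *ᵥ lam) z = G z y' * lam y' := by
  simp only [Matrix.mulVec, dotProduct]
  exact Finset.sum_eq_single y' (fun x _ hx => by rw [hlam x hx, mul_zero]) (fun h => absurd (Finset.mem_univ _) h)

/-- Moving one step costs a factor e^r: `e^{−r d(z,y′)} ≤ e^{r}e^{−r d(x,y′)}` if `d(x,z) ≤ 1`, r ≥ 0. [folklore] -/
private theorem exp_step (hr : 0 ≤ r) {x z : Fin d → Fin S} (hxz : bdist x z ≤ 1) (y' : Fin d → Fin S) :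
    Real.exp (-(r * bdist z y')) ≤ Real.exp r * Real.exp (-(r * bdist x y')) := by
  rw [← Real.exp_add]
  apply Real.exp_le_exp.mpr
  have h1 := bdist_triangle x z y'
  have h2 : r * bdist x y' ≤ r * bdist x z + r * bdist z y' := by nlinarith
  have h3 : r * bdist x z ≤ r * 1 := mul_le_mul_of_nonneg_left hxz hr
  linarith

/-- Entry 0: `|(G′λ)(y)| ≤ C₀e^{−rd(y,y′)}|λ(y′)|`. [cite: Balaban1984PropagatorsII, (2.67) p.234] -/
theorem entry0_le (hG : ∀ x y, |G x y| ≤ C₀ * Real.exp (-(r * bdist x y))) (hlam : ∀ x, x ≠ y' → lam x = 0)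
    (y : Fin d → Fin S) : |(G *ᵥ lam) y| ≤ C₀ * Real.exp (-(r * bdist y y')) * |lam y'| := by
  rw [mulVec_of_supp G hlam, abs_mul]
  exact mul_le_mul_of_nonneg_right (hG y y') (abs_nonneg _)

/-- Entry 1: `|(∇_μG′λ)(y)| ≤ C₀(e^r + 1)e^{−rd(y,y′)}|λ(y′)|` (the neighbour y + e_μ is one step away).
[cite: Balaban1984PropagatorsII, (2.67) p.234] -/
theorem entry1_le (hC₀ : 0 ≤ C₀) (hr : 0 ≤ r) (hG : ∀ x y, |G x y| ≤ C₀ * Real.exp (-(r * bdist x y)))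
    (hlam : ∀ x, x ≠ y' → lam x = 0) (μ : Fin d) (y : Fin d → Fin S) :
    |(fwdDiff μ *ᵥ (G *ᵥ lam)) y| ≤ C₀ * (Real.exp r + 1) * Real.exp (-(r * bdist y y')) * |lam y'| := by
  rw [fwdDiff_mulVec, mulVec_of_supp G hlam, mulVec_of_supp G hlam, ← sub_mul, abs_mul]
  refine mul_le_mul_of_nonneg_right ?_ (abs_nonneg _)
  have h1 : |G (shiftUp μ y) y'| ≤ C₀ * (Real.exp r * Real.exp (-(r * bdist y y'))) :=
    (hG _ _).trans (mul_le_mul_of_nonneg_left (exp_step hr (bdist_shiftUp_le μ y) y') hC₀)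
  have h2 := hG y y'
  calc |G (shiftUp μ y) y' - G y y'| ≤ |G (shiftUp μ y) y'| + |G y y'| := abs_sub _ _
    _ ≤ C₀ * (Real.exp r * Real.exp (-(r * bdist y y'))) + C₀ * Real.exp (-(r * bdist y y')) := add_le_add h1 h2
    _ = C₀ * (Real.exp r + 1) * Real.exp (-(r * bdist y y')) := by ring

/-- Entry 2: `|(G′∇_μ*λ)(y)| = |G′(y, y′ + e_μ) − G′(y, y′)||λ(y′)| ≤ C₀(e^r + 1)e^{−rd(y,y′)}|λ(y′)|`.
[cite: Balaban1984PropagatorsII, (2.67) p.234] -/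
theorem entry2_le (hC₀ : 0 ≤ C₀) (hr : 0 ≤ r) (hG : ∀ x y, |G x y| ≤ C₀ * Real.exp (-(r * bdist x y)))
    (hlam : ∀ x, x ≠ y' → lam x = 0) (μ : Fin d) (y : Fin d → Fin S) :
    |(G *ᵥ ((fwdDiff μ : Matrix (Fin d → Fin S) (Fin d → Fin S) ℝ)ᵀ *ᵥ lam)) y| ≤
      C₀ * (Real.exp r + 1) * Real.exp (-(r * bdist y y')) * |lam y'| := by
  rw [Matrix.mulVec_mulVec, mulVec_of_supp _ hlam, mul_fwdDiff_transpose_apply, abs_mul]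
  refine mul_le_mul_of_nonneg_right ?_ (abs_nonneg _)
  have hstep : Real.exp (-(r * bdist y (shiftUp μ y'))) ≤ Real.exp r * Real.exp (-(r * bdist y y')) := by
    have := exp_step hr (bdist_shiftUp_le μ y') y
    rw [bdist_comm (shiftUp μ y') y, bdist_comm y' y] at this
    exact this
  have h1 : |G y (shiftUp μ y')| ≤ C₀ * (Real.exp r * Real.exp (-(r * bdist y y'))) :=
    (hG _ _).trans (mul_le_mul_of_nonneg_left hstep hC₀)
  have h2 := hG y y'
  calc |G y (shiftUp μ y') - G y y'| ≤ |G y (shiftUp μ y')| + |G y y'| := abs_sub _ _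
    _ ≤ C₀ * (Real.exp r * Real.exp (-(r * bdist y y'))) + C₀ * Real.exp (-(r * bdist y y')) := add_le_add h1 h2
    _ = C₀ * (Real.exp r + 1) * Real.exp (-(r * bdist y y')) := by ring

/-- Entry 3 (the Laplacian entry): if `ΔG′ = 1 − aG′` (i.e. `(Δ + a)G′ = 1`, Δ′_a = Δ + a with Δ = ∂*∂ ≥ 0 as in (2.13)),
then `|(ΔG′λ)(y)| ≤ (1 + |a|C₀)e^{−rd(y,y′)}|λ(y′)|`. [cite: Balaban1984PropagatorsII, (2.67) p.234; (2.13) p.225] -/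
theorem entry3_le {Lm : Matrix (Fin d → Fin S) (Fin d → Fin S) ℝ} {a : ℝ}
    (hG : ∀ x y, |G x y| ≤ C₀ * Real.exp (-(r * bdist x y))) (hLG : Lm * G = 1 - a • G)
    (hlam : ∀ x, x ≠ y' → lam x = 0) (y : Fin d → Fin S) :
    |(Lm *ᵥ (G *ᵥ lam)) y| ≤ (1 + |a| * C₀) * Real.exp (-(r * bdist y y')) * |lam y'| := by
  rw [Matrix.mulVec_mulVec, hLG, mulVec_of_supp _ hlam, abs_mul, Matrix.sub_apply, Matrix.smul_apply,
    Matrix.one_apply, smul_eq_mul]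
  refine mul_le_mul_of_nonneg_right ?_ (abs_nonneg _)
  have hδ : |(if y = y' then (1 : ℝ) else 0)| ≤ Real.exp (-(r * bdist y y')) := by
    by_cases hy : y = y'
    · subst hy
      rw [if_pos rfl, bdist_self, mul_zero, neg_zero, Real.exp_zero, abs_one]
    · rw [if_neg hy, abs_zero]
      exact Real.exp_nonneg _
  calc |(if y = y' then (1 : ℝ) else 0) - a * G y y'|
      ≤ |(if y = y' then (1 : ℝ) else 0)| + |a * G y y'| := abs_sub _ _
    _ ≤ Real.exp (-(r * bdist y y')) + |a| * (C₀ * Real.exp (-(r * bdist y y'))) := by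
        rw [abs_mul]
        exact add_le_add hδ (mul_le_mul_of_nonneg_left (hG y y') (abs_nonneg _))
    _ = (1 + |a| * C₀) * Real.exp (-(r * bdist y y')) := by ring

/-- The Hölder entries on the unit lattice: for a cut-off ζ supported at one site y, `‖ζ·g‖_α ≤ |ζ(y)||g(y)|` (α ≥ 0).
[cite: Balaban1984PropagatorsII, (2.67) p.234] -/
theorem holder_mul_le [NeZero S] {α : ℝ} (hα : 0 ≤ α) {ζ : (Fin d → Fin S) → ℝ} {y : Fin d → Fin S}
    (hζ : ∀ x, x ≠ y → ζ x = 0) (g : (Fin d → Fin S) → ℝ) :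
    holderSemi α (fun x => ζ x * g x) ≤ |ζ y| * |g y| := by
  rw [← abs_mul]
  exact holderSemi_le_of_supp hα (f := fun x => ζ x * g x) fun x hx => by simp [hζ x hx]

end EntryBounds

/-! ## §2. Proposition 2.2 verbatim on the one-scale box family -/

section Family

/-- **PROPOSITION 2.2 IN ITS PRINTED TYPING `B6.Prop22Printed`, INHABITED BY THE ONE-SCALE BOX FAMILY WITH NO ANALYTIC
HYPOTHESIS.**  For every dimension d and mass a > 0, on the family of one-scale boxes {0,…,nM}^d indexed by
(n, M) ∈ ℕ × ℕ (`oneScaleGeo`, honest readings) with G′ = (−Δ_𝔅 + a)⁻¹ and its (2.67)-family `boxGp`, the printed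
Proposition 2.2 holds: there are M₁, δ₀, C, C_α — depending on d and a only, UNIFORM in the volume n and in M ≥ M₁ — with
all four sup entries `|(G′λ)(y)|, Σ_μ|(∇_μG′λ)(y)|, Σ_μ|(G′∇_μ*λ)(y)|, |(ΔG′λ)(y)| ≤ C·[1,1,1,1]·e^{−½δ₀|y−y′|₁}|λ|` and the
Hölder entries `≤ C_α·1^{1−α}·(‖ζ‖_α + |ζ|)·e^{−½δ₀|y−y′|₁}|λ|` for supp λ ⊂ {y′}, supp ζ ⊂ {y}, 0 ≤ α < 1, whenever M ≥ M₁
(*"M sufficiently large"*).  Source of the decay: `B6Prop22BoxLaplacian.prop22_entry1_neumannLaplacian` (the printed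
random-walk route (2.36)–(2.66) on the model, this seat's p248732/p248905) at δ₀ = log(1 + a/(4(d+1))), α = ½, with
(1 − X/M)⁻¹ ≤ 2 for M ≥ 2X + 1; the other entries follow on the unit lattice from the kernel decay (§2).
[cite: Balaban1984PropagatorsII, Prop. 2.2 (2.67) p.234] -/
theorem prop22Printed_boxFamily (d : ℕ) {a : ℝ} (ha : 0 < a) :
    B6.Prop22Printed (fun i : ℕ × ℕ => oneScaleGeo d i.1 i.2) (fun i => boxGp d i.1 i.2 a) := by
  classical
  -- the rate δ₀ = log(1 + a/(4(d+1))): 2d(e^{δ₀} − 1) = a·d/(2(d+1)) < a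
  set δ₀ : ℝ := Real.log (1 + a / (4 * (d + 1))) with hδ₀def
  have hq : 0 < a / (4 * ((d : ℝ) + 1)) := by positivity
  have hδ₀ : 0 < δ₀ := Real.log_pos (by linarith)
  have hexp : Real.exp δ₀ = 1 + a / (4 * (d + 1)) := by rw [hδ₀def, Real.exp_log (by linarith)]
  have hρ : 2 * (d : ℝ) * (Real.exp δ₀ - 1) < a := by
    rw [hexp, add_sub_cancel_left]
    have hd1 : (0 : ℝ) < 4 * ((d : ℝ) + 1) := by positivity
    rw [mul_div_assoc', div_lt_iff₀ hd1]
    nlinarith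
  set A : ℝ := (a - 2 * d * (Real.exp δ₀ - 1))⁻¹ with hAdef
  have hA : 0 < A := inv_pos.mpr (by linarith)
  set K : ℝ := Kbox d (1 / 2 * δ₀) with hKdef
  have hK : 0 ≤ K := B6CoverBox.Kbox_nonneg d (by linarith)
  set X : ℝ := (2 : ℝ) ^ d * (3 * Real.pi / 2 * A * (2 * d * Real.exp δ₀)) * K with hXdef
  have hX : 0 ≤ X := by positivity
  set C₀ : ℝ := 2 * ((2 : ℝ) ^ d * A * K) with hC₀def
  have hC₀ : 0 ≤ C₀ := by positivity
  set r : ℝ := δ₀ / 2 with hrdef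
  have hr : 0 ≤ r := by positivity
  set C : ℝ := 1 + |a| * C₀ + ((d : ℝ) + 1) * (C₀ * (Real.exp r + 1)) with hCdef
  have hC : 0 < C := by positivity
  refine ⟨2 * X + 1, δ₀, C, fun _ => 2 * d * (C₀ * (Real.exp r + 1)), by positivity, hδ₀, hC, ?_⟩
  rintro ⟨n, m⟩ _ hM
  change 2 * X + 1 ≤ (m : ℝ) at hM
  have hm1 : (1 : ℝ) ≤ m := by linarith
  have hm : 0 < m := by exact_mod_cast (show (0 : ℝ) < m by linarith)
  have hmR : (0 : ℝ) < m := by exact_mod_cast hm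
  -- the kernel bound from the companion, with the m-dependence of its constant removed
  have hXm : X < m := by linarith
  have hfrac : (1 - (2 : ℝ) ^ d * (3 * Real.pi / 2 * A * (2 * d * Real.exp δ₀) / m) * K)⁻¹ ≤ 2 := by
    have hXm' : (2 : ℝ) ^ d * (3 * Real.pi / 2 * A * (2 * d * Real.exp δ₀) / m) * K = X / m := by
      rw [hXdef]; field_simp
    rw [hXm']
    have h1 : X / m ≤ 1 / 2 := by
      rw [div_le_iff₀ hmR]; linarith
    have h2 : (1 : ℝ) / 2 ≤ 1 - X / m := by linarith
    calc (1 - X / m)⁻¹ ≤ (1 / 2 : ℝ)⁻¹ := inv_anti₀ (by norm_num) h2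
      _ = 2 := by norm_num
  have hker : ∀ x y : Fin d → Fin (n * m + 1), |green d n m a x y| ≤ C₀ * Real.exp (-(r * bdist x y)) := by
    intro x y
    have h := prop22_entry1_neumannLaplacian (d := d) (n := n) (m := m) hm ha hδ₀ (α := 1 / 2) (by norm_num)
      (by norm_num) hρ (by simpa only [hXdef] using hXm) x y
    have hrate : -((1 - 1 / 2) * δ₀ * bdist x y) = -(r * bdist x y) := by rw [hrdef]; ring
    rw [hrate] at h
    refine le_trans h ?_
    have hE : 0 ≤ Real.exp (-(r * bdist x y)) := Real.exp_nonneg _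
    calc (2 : ℝ) ^ d * A * K * (1 - (2 : ℝ) ^ d * (3 * Real.pi / 2 * A * (2 * d * Real.exp δ₀) / m) * K)⁻¹ *
          Real.exp (-(r * bdist x y))
        ≤ (2 : ℝ) ^ d * A * K * 2 * Real.exp (-(r * bdist x y)) := by
          refine mul_le_mul_of_nonneg_right ?_ hE
          exact mul_le_mul_of_nonneg_left hfrac (by positivity)
      _ = C₀ * Real.exp (-(r * bdist x y)) := by rw [hC₀def]; ring
  have hLG := negLap_mul_green d n m ha
  refine ⟨fun i lam y y' hsupp => ?_, fun α lam ζ y y' hα0 _ hζ hsupp => ?_⟩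
  · -- the four sup entries
    have hly : |lam y'| ≤ ‖lam‖ := by rw [← Real.norm_eq_abs]; exact norm_le_pi_norm lam y'
    have hrate : -(δ₀ / 2 * bdist y y') = -(r * bdist y y') := by rw [hrdef]
    rw [oneScaleGeo_len, pref4_one, mul_one]
    change _ ≤ C * Real.exp (-(δ₀ / 2 * bdist y y')) * ‖lam‖
    rw [hrate]
    have hE : 0 ≤ Real.exp (-(r * bdist y y')) := Real.exp_nonneg _
    have hmono : ∀ {t c : ℝ}, t ≤ c * Real.exp (-(r * bdist y y')) * |lam y'| → c ≤ C →
        t ≤ C * Real.exp (-(r * bdist y y')) * ‖lam‖ := by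
      intro t c ht hc
      refine ht.trans ?_
      have hc0 : c * Real.exp (-(r * bdist y y')) * |lam y'| ≤ C * Real.exp (-(r * bdist y y')) * |lam y'| :=
        mul_le_mul_of_nonneg_right (mul_le_mul_of_nonneg_right hc hE) (abs_nonneg _)
      exact hc0.trans (mul_le_mul_of_nonneg_left hly (by positivity))
    have hC0le : C₀ ≤ C := by
      rw [hCdef]
      have : C₀ ≤ ((d : ℝ) + 1) * (C₀ * (Real.exp r + 1)) := by
        have h1 : C₀ ≤ C₀ * (Real.exp r + 1) := le_mul_of_one_le_right hC₀ (by linarith [Real.exp_nonneg r])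
        have h2 : C₀ * (Real.exp r + 1) ≤ ((d : ℝ) + 1) * (C₀ * (Real.exp r + 1)) :=
          le_mul_of_one_le_left (by positivity) (by linarith [(Nat.cast_nonneg d : (0 : ℝ) ≤ d)])
        exact h1.trans h2
      nlinarith [abs_nonneg a]
    have hC1le : (d : ℝ) * (C₀ * (Real.exp r + 1)) ≤ C := by
      rw [hCdef]
      nlinarith [abs_nonneg a, Real.exp_nonneg r]
    have hC3le : 1 + |a| * C₀ ≤ C := by
      rw [hCdef]
      have : 0 ≤ ((d : ℝ) + 1) * (C₀ * (Real.exp r + 1)) := by positivity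
      linarith
    fin_cases i
    · -- |(G′λ)(y)|
      change |(green d n m a *ᵥ lam) y| ≤ _
      exact hmono (entry0_le hker hsupp y) hC0le
    · -- Σ_μ |(∇_μG′λ)(y)|
      change ∑ μ : Fin d, |(fwdDiff μ *ᵥ (green d n m a *ᵥ lam)) y| ≤ _
      refine hmono ?_ hC1le
      calc ∑ μ : Fin d, |(fwdDiff μ *ᵥ (green d n m a *ᵥ lam)) y|
          ≤ ∑ _μ : Fin d, C₀ * (Real.exp r + 1) * Real.exp (-(r * bdist y y')) * |lam y'| :=
            Finset.sum_le_sum fun μ _ => entry1_le hC₀ hr hker hsupp μ y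
        _ = (d : ℝ) * (C₀ * (Real.exp r + 1)) * Real.exp (-(r * bdist y y')) * |lam y'| := by
            rw [Finset.sum_const, Finset.card_univ, Fintype.card_fin, nsmul_eq_mul]; ring
    · -- Σ_μ |(G′∇_μ*λ)(y)|
      change ∑ μ : Fin d, |(green d n m a *ᵥ ((fwdDiff μ : Matrix _ _ ℝ)ᵀ *ᵥ lam)) y| ≤ _
      refine hmono ?_ hC1le
      calc ∑ μ : Fin d, |(green d n m a *ᵥ ((fwdDiff μ : Matrix _ _ ℝ)ᵀ *ᵥ lam)) y|
          ≤ ∑ _μ : Fin d, C₀ * (Real.exp r + 1) * Real.exp (-(r * bdist y y')) * |lam y'| :=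
            Finset.sum_le_sum fun μ _ => entry2_le hC₀ hr hker hsupp μ y
        _ = (d : ℝ) * (C₀ * (Real.exp r + 1)) * Real.exp (-(r * bdist y y')) * |lam y'| := by
            rw [Finset.sum_const, Finset.card_univ, Fintype.card_fin, nsmul_eq_mul]; ring
    · -- |(ΔG′λ)(y)|
      change |(negLap d n m *ᵥ (green d n m a *ᵥ lam)) y| ≤ _
      exact hmono (entry3_le hker hLG hsupp y) hC3le
  · -- the Hölder entries
    have hly : |lam y'| ≤ ‖lam‖ := by rw [← Real.norm_eq_abs]; exact norm_le_pi_norm lam y'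
    have hζy : |ζ y| ≤ holderSemi α ζ + ‖ζ‖ := by
      have h1 : |ζ y| ≤ ‖ζ‖ := by rw [← Real.norm_eq_abs]; exact norm_le_pi_norm ζ y
      have h2 : 0 ≤ holderSemi α ζ := holderSemi_nonneg α ζ
      linarith
    have hrate : -(δ₀ / 2 * bdist y y') = -(r * bdist y y') := by rw [hrdef]
    rw [oneScaleGeo_len, Real.one_rpow, mul_one]
    change ∑ μ : Fin d, (holderSemi α (fun x => ζ x * (fwdDiff μ *ᵥ (green d n m a *ᵥ lam)) x) +
        holderSemi α (fun x => ζ x * (green d n m a *ᵥ ((fwdDiff μ : Matrix _ _ ℝ)ᵀ *ᵥ lam)) x)) ≤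
      2 * d * (C₀ * (Real.exp r + 1)) * (holderSemi α ζ + ‖ζ‖) * Real.exp (-(δ₀ / 2 * bdist y y')) * ‖lam‖
    rw [hrate]
    have hE : 0 ≤ Real.exp (-(r * bdist y y')) := Real.exp_nonneg _
    have hterm : ∀ μ : Fin d,
        holderSemi α (fun x => ζ x * (fwdDiff μ *ᵥ (green d n m a *ᵥ lam)) x) +
          holderSemi α (fun x => ζ x * (green d n m a *ᵥ ((fwdDiff μ : Matrix _ _ ℝ)ᵀ *ᵥ lam)) x) ≤
        2 * ((holderSemi α ζ + ‖ζ‖) * (C₀ * (Real.exp r + 1) * Real.exp (-(r * bdist y y')) * ‖lam‖)) := by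
      intro μ
      have hz0 : 0 ≤ holderSemi α ζ + ‖ζ‖ := add_nonneg (holderSemi_nonneg α ζ) (norm_nonneg _)
      have hc0 : 0 ≤ C₀ * (Real.exp r + 1) * Real.exp (-(r * bdist y y')) := by positivity
      have b1 := (holder_mul_le hα0 hζ (fun x => (fwdDiff μ *ᵥ (green d n m a *ᵥ lam)) x)).trans
        (mul_le_mul hζy ((entry1_le hC₀ hr hker hsupp μ y).trans
          (mul_le_mul_of_nonneg_left hly hc0)) (abs_nonneg _) hz0)
      have b2 := (holder_mul_le hα0 hζ (fun x => (green d n m a *ᵥ ((fwdDiff μ : Matrix _ _ ℝ)ᵀ *ᵥ lam)) x)).trans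
        (mul_le_mul hζy ((entry2_le hC₀ hr hker hsupp μ y).trans
          (mul_le_mul_of_nonneg_left hly hc0)) (abs_nonneg _) hz0)
      linarith
    calc ∑ μ : Fin d, (holderSemi α (fun x => ζ x * (fwdDiff μ *ᵥ (green d n m a *ᵥ lam)) x) +
          holderSemi α (fun x => ζ x * (green d n m a *ᵥ ((fwdDiff μ : Matrix _ _ ℝ)ᵀ *ᵥ lam)) x))
        ≤ ∑ _μ : Fin d, 2 * ((holderSemi α ζ + ‖ζ‖) * (C₀ * (Real.exp r + 1) * Real.exp (-(r * bdist y y')) *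
            ‖lam‖)) := Finset.sum_le_sum fun μ _ => hterm μ
      _ = 2 * d * (C₀ * (Real.exp r + 1)) * (holderSemi α ζ + ‖ζ‖) * Real.exp (-(r * bdist y y')) * ‖lam‖ := by
          rw [Finset.sum_const, Finset.card_univ, Fintype.card_fin, nsmul_eq_mul]; ring

end Family

/-! ## §3. Non-vacuity of the inhabited Proposition (v1.1) -/

section NonVacuity

/-- **The verbatim Prop. 2.2 is inhabited NON-VACUOUSLY by the box family.**  `B6.Prop22Printed` asserts its bounds for the
members with `Hyp21_22` and `M₁ ≤ M` only; on the one-scale box family (2.1)/(2.2) read `True` and the block-size parameter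
M is the second index, so for EVERY threshold M₁ (in particular the witness 2X + 1 of `prop22Printed_boxFamily`) and EVERY
aspect parameter n there is a member (n, M) meeting both hypotheses — the conclusion of `prop22Printed_boxFamily` is in force
on boxes {0,…,nM}^d of every n and every M ≥ M₁ (*"M sufficiently large"*, p. 234), not on an empty subfamily.
[cite: Balaban1984PropagatorsII, Prop. 2.2 (2.67) p.234] -/
theorem boxFamily_meets_hypotheses (d : ℕ) (M₁ : ℝ) (n : ℕ) :
    ∃ M : ℕ, (oneScaleGeo d n M).Hyp21_22 ∧ M₁ ≤ (oneScaleGeo d n M).M := by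
  obtain ⟨M, hM⟩ := exists_nat_ge M₁
  exact ⟨M, trivial, hM⟩

/-- The index set on which `prop22Printed_boxFamily` asserts (2.67) is infinite in the block size: every member (n, M′)
with M′ ≥ M (M from `boxFamily_meets_hypotheses`) again meets both hypotheses.
[cite: Balaban1984PropagatorsII, Prop. 2.2 (2.67) p.234] -/
theorem boxFamily_meets_hypotheses_mono (d : ℕ) {M₁ : ℝ} {n M M' : ℕ} (hM : M₁ ≤ (oneScaleGeo d n M).M)
    (hMM' : M ≤ M') : (oneScaleGeo d n M').Hyp21_22 ∧ M₁ ≤ (oneScaleGeo d n M').M :=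
  ⟨trivial, hM.trans (show (M : ℝ) ≤ (M' : ℝ) by exact_mod_cast hMM')⟩

end NonVacuity

end

end Literature.MathematicalPhysics.QuantumFieldTheory.Balaban1983to89.B6Prop22BoxFamily
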